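import Literature.NumberTheory.LFunctions.ConreyIwaniec2002NonstationaryPhase
import HarnessLib

/-!
# Conrey–Iwaniec (2002), §4 (4.22)–(4.23): the oscillatory piece of the kernel bound

B. Conrey, H. Iwaniec, *Spacing of zeros of Hecke L-functions and the class number problem*,
Acta Arith. 103 (2002) 259–312, §4 [held text `paper:arxiv-math_0111012`, p0012]: "we can show
that `|α|cC ≤ 1`, so there is no stationary phase in the Fourier integral
`ĝ_m(α) = ∫ g(x)e(αx)k_m(x)dx`. Therefore by partial integration two times we get
`ĝ_m(α) ≪ X(c²r/mX)^{5/4}`". This file (cell `landau-siegel/ls-inputs`, line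
`theta-circle-method`, towards the registered stub S3c `stub_bessel_kernel`) proves the
corresponding estimate for ONE oscillatory piece after the substitution `x = t²`
(`norm_integral_piece_le`): for `ε = ±1`, a dyadic test function `g` on `[X, 2X]`, any envelope
`W` with `|W^{(ν)}(u)| ≤ K u^{-1/2-ν}` (`ν ≤ 2`, `u ≥ 2`), `a√X ≥ 2` and `4π|α|√(2X) ≤ 3a/4`,
`|∫_{√X}^{√(2X)} t g(t²) W(at) e^{i(εat − 2παt²)} dt| ≤ 1552·K/(a²√(a√X))`
— the phase has `|φ'| ≥ a/4`, `|φ''| = 4π|α|`, `φ''' = 0`, the amplitude `t g(t²) W(at)` has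
`|A| ≤ √(2X)K/√(a√X)`, `|A'| ≤ 4K/√(a√X)`, `|A''| ≤ 17K/(√X√(a√X))`, and
`norm_integral_mul_cexp_le_of_nonstationary` applies.

«The programme SEARCHES and TYPES; no claim about Landau–Siegel zeros, Theorems 1–2 of
arXiv:2211.02515 or a repaired Margin232 until a kernel theorem says so.»

## References

* [ConreyIwaniec2002] B. Conrey, H. Iwaniec, *Spacing of zeros of Hecke L-functions and the class
  number problem*, Acta Arith. 103 (2002) 259–312, arXiv:math/0111012: §4 (4.5), (4.22)–(4.24).
* G. N. Watson, *A Treatise on the Theory of Bessel Functions* (2nd ed., 1944), §7.21 (Hankel's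
  expansions; here replaced by the elementary envelope built from `J₀`, `J₁`).
-/

noncomputable section

open Complex Real Set MeasureTheory Filter intervalIntegral
open scoped Topology Interval FourierTransform

namespace Literature.NumberTheory.LFunctions

namespace ConreyIwaniec2002

section Piece

set_option maxHeartbeats 400000 in
/-- **The oscillatory integrals of (4.22)–(4.23) have no stationary point.** For `ε = ±1`, a
dyadic test function `g` on `[X, 2X]`, an "envelope" `W` with the symbol bounds
`|W^{(ν)}(u)| ≤ K u^{-1/2-ν}` (`ν ≤ 2`, `u ≥ 2`), `a > 0` with `a√X ≥ 2` and
`4π|α|√(2X) ≤ (3/4)a`: the phase `φ(t) = εat − 2παt²` has `|φ'| ≥ a/4` on `[√X, √(2X)]`, and two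
integrations by parts (`norm_integral_mul_cexp_le_of_nonstationary`) bound
`∫_{√X}^{√(2X)} t·g(t²)·W(at)·e^{iφ(t)}dt`. [cite: ConreyIwaniec2002, §4 (4.22)–(4.23)] -/
theorem norm_integral_piece_le {X : ℝ} (hX : 1 / 2 ≤ X) {g : ℝ → ℂ} (hg : IsBumpOn X g)
    {K : ℝ} (hK : 0 ≤ K) {W W' W'' : ℝ → ℂ}
    (hWd : ∀ u : ℝ, u ≠ 0 → HasDerivAt W (W' u) u)
    (hW'd : ∀ u : ℝ, u ≠ 0 → HasDerivAt W' (W'' u) u)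
    (hW''c : ∀ u : ℝ, u ≠ 0 → ContinuousAt W'' u)
    (hW0 : ∀ u : ℝ, 2 ≤ u → ‖W u‖ ≤ K / Real.sqrt u)
    (hW1 : ∀ u : ℝ, 2 ≤ u → ‖W' u‖ ≤ K / (u * Real.sqrt u))
    (hW2 : ∀ u : ℝ, 2 ≤ u → ‖W'' u‖ ≤ K / (u ^ 2 * Real.sqrt u))
    {ε : ℝ} (hε : ε = 1 ∨ ε = -1) {a α : ℝ} (ha : 0 < a) (hu₀ : 2 ≤ a * Real.sqrt X)
    (hαa : 4 * Real.pi * |α| * Real.sqrt (2 * X) ≤ 3 / 4 * a) :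
    ‖∫ t in Real.sqrt X..Real.sqrt (2 * X),
        (t : ℂ) * g (t ^ 2) * W (a * t) * cexp (I * (ε * a * t - 2 * Real.pi * α * t ^ 2 : ℝ))‖ ≤
      1552 * K / (a ^ 2 * Real.sqrt (a * Real.sqrt X)) := by
  -- the interval
  set t₁ : ℝ := Real.sqrt X with ht₁
  set t₂ : ℝ := Real.sqrt (2 * X) with ht₂
  set u₀ : ℝ := a * t₁ with hu₀def
  have hX0 : 0 < X := by linarith
  have ht₁0 : 0 < t₁ := Real.sqrt_pos.mpr hX0
  have ht₁₂ : t₁ ≤ t₂ := Real.sqrt_le_sqrt (by linarith)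
  have ht₁sq : t₁ ^ 2 = X := Real.sq_sqrt hX0.le
  have ht₂sq : t₂ ^ 2 = 2 * X := Real.sq_sqrt (by linarith)
  have hu₀2 : 2 ≤ u₀ := hu₀
  have hu₀0 : 0 < u₀ := by linarith
  have hsu₀ : 0 < Real.sqrt u₀ := Real.sqrt_pos.mpr hu₀0
  -- facts on `[t₁, t₂]`
  have hI : ∀ t ∈ Icc t₁ t₂, 0 < t ∧ t ≤ t₂ ∧ 2 ≤ a * t ∧ u₀ ≤ a * t ∧ a * t ≠ 0 := by
    intro t ht
    have h1 : 0 < t := lt_of_lt_of_le ht₁0 ht.1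
    have h2 : u₀ ≤ a * t := mul_le_mul_of_nonneg_left ht.1 ha.le
    exact ⟨h1, ht.2, le_trans hu₀2 h2, h2, (mul_pos ha h1).ne'⟩
  -- the test function
  obtain ⟨hd, hd1, hd2c⟩ := hg.derivs
  have hG : ∀ t : ℝ, HasDerivAt (fun y : ℝ ↦ g (y ^ 2)) ((2 * t : ℝ) • deriv g (t ^ 2)) t := by
    intro t
    have h1 : HasDerivAt (fun y : ℝ ↦ y ^ 2) (2 * t) t := by simpa using hasDerivAt_pow 2 t
    exact (hd (t ^ 2)).hasDerivAt.scomp t h1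
  have hG' : ∀ t : ℝ, HasDerivAt (fun y : ℝ ↦ deriv g (y ^ 2))
      ((2 * t : ℝ) • deriv (deriv g) (t ^ 2)) t := by
    intro t
    have h1 : HasDerivAt (fun y : ℝ ↦ y ^ 2) (2 * t) t := by simpa using hasDerivAt_pow 2 t
    exact (hd1 (t ^ 2)).hasDerivAt.scomp t h1
  -- the envelope along `t ↦ a t`
  have hlin : ∀ t : ℝ, HasDerivAt (fun y : ℝ ↦ a * y) a t := by
    intro t; simpa using (hasDerivAt_id' t).const_mul a
  have hV : ∀ t ∈ Icc t₁ t₂, HasDerivAt (fun y : ℝ ↦ W (a * y)) (a • W' (a * t)) t :=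
    fun t ht ↦ (hWd (a * t) (hI t ht).2.2.2.2).scomp t (hlin t)
  have hV' : ∀ t ∈ Icc t₁ t₂, HasDerivAt (fun y : ℝ ↦ W' (a * y)) (a • W'' (a * t)) t :=
    fun t ht ↦ (hW'd (a * t) (hI t ht).2.2.2.2).scomp t (hlin t)
  have hv : ∀ t : ℝ, HasDerivAt (fun y : ℝ ↦ (y : ℂ)) 1 t := fun t ↦ (hasDerivAt_id t).ofReal_comp
  -- amplitude and its derivatives
  set A : ℝ → ℂ := fun t ↦ (t : ℂ) * g (t ^ 2) * W (a * t) with hA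
  set A' : ℝ → ℂ := fun t ↦ g (t ^ 2) * W (a * t) + 2 * (t : ℂ) ^ 2 * deriv g (t ^ 2) * W (a * t) +
      a * (t : ℂ) * g (t ^ 2) * W' (a * t) with hA'
  set A'' : ℝ → ℂ := fun t ↦ 6 * (t : ℂ) * deriv g (t ^ 2) * W (a * t) +
      4 * (t : ℂ) ^ 3 * deriv (deriv g) (t ^ 2) * W (a * t) + 2 * (a : ℂ) * g (t ^ 2) * W' (a * t) +
      4 * (a : ℂ) * (t : ℂ) ^ 2 * deriv g (t ^ 2) * W' (a * t) +
      (a : ℂ) ^ 2 * t * g (t ^ 2) * W'' (a * t) with hA''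
  have hAd : ∀ t ∈ Icc t₁ t₂, HasDerivAt A (A' t) t := by
    intro t ht
    have h := ((hv t).fun_mul (hG t)).fun_mul (hV t ht)
    refine h.congr_deriv ?_
    rw [hA']
    simp only [Complex.real_smul]
    push_cast
    ring
  have hA'd : ∀ t ∈ Icc t₁ t₂, HasDerivAt A' (A'' t) t := by
    intro t ht
    have h1 := (hG t).fun_mul (hV t ht)
    have h2 := ((((hv t).fun_pow 2).const_mul (2 : ℂ)).fun_mul (hG' t)).fun_mul (hV t ht)
    have h3 := ((((hv t).const_mul (a : ℂ))).fun_mul (hG t)).fun_mul (hV' t ht)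
    have h := (h1.fun_add h2).fun_add h3
    refine h.congr_deriv ?_
    rw [hA'']
    simp only [Complex.real_smul]
    push_cast
    ring
  have hA''c : ContinuousOn A'' (Icc t₁ t₂) := by
    have hcW : ContinuousOn (fun t : ℝ ↦ W (a * t)) (Icc t₁ t₂) :=
      fun t ht ↦ (hV t ht).continuousAt.continuousWithinAt
    have hcW' : ContinuousOn (fun t : ℝ ↦ W' (a * t)) (Icc t₁ t₂) :=
      fun t ht ↦ (hV' t ht).continuousAt.continuousWithinAt
    have hcW'' : ContinuousOn (fun t : ℝ ↦ W'' (a * t)) (Icc t₁ t₂) := by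
      intro t ht
      have h := hW''c (a * t) (hI t ht).2.2.2.2
      exact (h.comp (continuous_const.mul continuous_id).continuousAt).continuousWithinAt
    have hcg : Continuous (fun t : ℝ ↦ g (t ^ 2)) := hd.continuous.comp (continuous_id.pow 2)
    have hcg' : Continuous (fun t : ℝ ↦ deriv g (t ^ 2)) := hd1.continuous.comp (continuous_id.pow 2)
    have hcg'' : Continuous (fun t : ℝ ↦ deriv (deriv g) (t ^ 2)) :=
      hd2c.comp (continuous_id.pow 2)
    have hct : Continuous (fun t : ℝ ↦ (t : ℂ)) := continuous_ofReal
    rw [hA'']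
    refine (((ContinuousOn.add (ContinuousOn.add (ContinuousOn.add ?_ ?_) ?_) ?_).add ?_))
    · exact ((continuousOn_const.mul hct.continuousOn).mul hcg'.continuousOn).mul hcW
    · exact (((continuousOn_const.mul (hct.pow 3).continuousOn)).mul hcg''.continuousOn).mul hcW
    · exact (continuousOn_const.mul hcg.continuousOn).mul hcW'
    · exact (((continuousOn_const.mul (hct.pow 2).continuousOn)).mul hcg'.continuousOn).mul hcW'
    · exact ((continuousOn_const.mul hct.continuousOn).mul hcg.continuousOn).mul hcW''
  -- vanishing at the endpoints
  have hz₁ := hg.eq_zero_of_not_mem_Ioo (x := X) (fun h ↦ lt_irrefl X h.1)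
  have hz₂ := hg.eq_zero_of_not_mem_Ioo (x := 2 * X) (fun h ↦ lt_irrefl (2 * X) h.2)
  have hAz₁ : A t₁ = 0 := by simp only [hA, ht₁sq, hz₁.1]; simp
  have hAz₂ : A t₂ = 0 := by simp only [hA, ht₂sq, hz₂.1]; simp
  have hA'z₁ : A' t₁ = 0 := by simp only [hA', ht₁sq, hz₁.1, hz₁.2]; simp
  have hA'z₂ : A' t₂ = 0 := by simp only [hA', ht₂sq, hz₂.1, hz₂.2]; simp
  -- the phase
  set φ : ℝ → ℝ := fun t ↦ ε * a * t - 2 * Real.pi * α * t ^ 2 with hφ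
  set φ' : ℝ → ℝ := fun t ↦ ε * a - 4 * Real.pi * α * t with hφ'
  set φ'' : ℝ → ℝ := fun _ ↦ -(4 * Real.pi * α) with hφ''
  set φ''' : ℝ → ℝ := fun _ ↦ 0 with hφ'''
  have hφd : ∀ t ∈ Icc t₁ t₂, HasDerivAt φ (φ' t) t := by
    intro t _
    have h := (((hasDerivAt_id' t).const_mul (ε * a))).fun_sub
      (((hasDerivAt_id' t).fun_pow 2).const_mul (2 * Real.pi * α))
    refine h.congr_deriv ?_
    simp only [hφ']; ring
  have hφ'd : ∀ t ∈ Icc t₁ t₂, HasDerivAt φ' (φ'' t) t := by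
    intro t _
    have h := (hasDerivAt_const t (ε * a)).fun_sub ((hasDerivAt_id' t).const_mul (4 * Real.pi * α))
    refine h.congr_deriv ?_
    simp only [hφ'']; ring
  have hφ''d : ∀ t ∈ Icc t₁ t₂, HasDerivAt φ'' (φ''' t) t := fun t _ ↦ hasDerivAt_const t _
  have hφ'''c : ContinuousOn φ''' (Icc t₁ t₂) := continuousOn_const
  -- size of `φ'`: no stationary point
  have hεabs : |ε| = 1 := by rcases hε with h | h <;> simp [h]
  have hμ : ∀ t ∈ Icc t₁ t₂, a / 4 ≤ |φ' t| := by
    intro t ht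
    obtain ⟨ht0, htt₂, -, -, -⟩ := hI t ht
    have h1 : |4 * Real.pi * α * t| ≤ 3 / 4 * a := by
      have e : |4 * Real.pi * α * t| = 4 * Real.pi * |α| * t := by
        rw [abs_mul, abs_mul, abs_mul, abs_of_pos ht0, abs_of_pos Real.pi_pos]
        norm_num
      rw [e]
      calc 4 * Real.pi * |α| * t ≤ 4 * Real.pi * |α| * t₂ := by gcongr
        _ ≤ 3 / 4 * a := hαa
    have h2 : |ε * a| = a := by rw [abs_mul, hεabs, one_mul, abs_of_pos ha]
    have h3 := abs_sub_abs_le_abs_sub (ε * a) (4 * Real.pi * α * t)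
    rw [h2] at h3
    simp only [hφ']
    linarith
  have hM₂ : ∀ t ∈ Icc t₁ t₂, |φ'' t| ≤ 4 * Real.pi * |α| := by
    intro t _
    simp only [hφ'', abs_neg, abs_mul, abs_of_pos Real.pi_pos]
    norm_num
  have hM₃ : ∀ t ∈ Icc t₁ t₂, |φ''' t| ≤ 0 := fun t _ ↦ by simp [hφ''']
  -- bounds for `g`, `W` along the interval
  have hB : ∀ t ∈ Icc t₁ t₂, ‖g (t ^ 2)‖ ≤ 1 ∧ ‖deriv g (t ^ 2)‖ ≤ 1 / t ^ 2 ∧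
      ‖deriv (deriv g) (t ^ 2)‖ ≤ 1 / t ^ 4 ∧ ‖W (a * t)‖ ≤ K / Real.sqrt u₀ ∧
      ‖W' (a * t)‖ ≤ K / (a * t * Real.sqrt u₀) ∧ ‖W'' (a * t)‖ ≤ K / ((a * t) ^ 2 * Real.sqrt u₀) := by
    intro t ht
    obtain ⟨ht0, -, hat2, hu₀at, hat0⟩ := hI t ht
    obtain ⟨b0, b1, b2⟩ := hg.bounds (t ^ 2)
    have ht2 : 0 < t ^ 2 := by positivity
    have hsq : Real.sqrt u₀ ≤ Real.sqrt (a * t) := Real.sqrt_le_sqrt hu₀at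
    have hat : 0 < a * t := mul_pos ha ht0
    refine ⟨b0, ?_, ?_, ?_, ?_, ?_⟩
    · rw [le_div_iff₀ ht2]; linarith
    · rw [le_div_iff₀ (by positivity)]
      have : (t ^ 2) ^ 2 * ‖deriv (deriv g) (t ^ 2)‖ ≤ 1 := b2
      nlinarith
    · exact (hW0 _ hat2).trans (div_le_div_of_nonneg_left hK hsu₀ hsq)
    · exact (hW1 _ hat2).trans (div_le_div_of_nonneg_left hK (by positivity) (by gcongr))
    · exact (hW2 _ hat2).trans (div_le_div_of_nonneg_left hK (by positivity) (by gcongr))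
  -- bounds for the amplitude
  have hnt : ∀ t : ℝ, ‖(t : ℂ)‖ = |t| := fun t ↦ by rw [Complex.norm_real, Real.norm_eq_abs]
  have ha₀ : ∀ t ∈ Icc t₁ t₂, ‖A t‖ ≤ t₂ * K / Real.sqrt u₀ := by
    intro t ht
    obtain ⟨ht0, htt₂, -, -, -⟩ := hI t ht
    obtain ⟨b0, -, -, w0, -, -⟩ := hB t ht
    simp only [hA]
    rw [norm_mul, norm_mul, hnt, abs_of_pos ht0]
    calc t * ‖g (t ^ 2)‖ * ‖W (a * t)‖ ≤ t₂ * 1 * (K / Real.sqrt u₀) := by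
          gcongr
      _ = t₂ * K / Real.sqrt u₀ := by ring
  have ha₁ : ∀ t ∈ Icc t₁ t₂, ‖A' t‖ ≤ 4 * K / Real.sqrt u₀ := by
    intro t ht
    obtain ⟨ht0, htt₂, -, -, hat0⟩ := hI t ht
    obtain ⟨b0, b1, -, w0, w1, -⟩ := hB t ht
    have hat : 0 < a * t := mul_pos ha ht0
    simp only [hA']
    have e1 : ‖g (t ^ 2) * W (a * t)‖ ≤ 1 * (K / Real.sqrt u₀) := by
      rw [norm_mul]; gcongr
    have e2 : ‖2 * (t : ℂ) ^ 2 * deriv g (t ^ 2) * W (a * t)‖ ≤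
        2 * t ^ 2 * (1 / t ^ 2) * (K / Real.sqrt u₀) := by
      rw [norm_mul, norm_mul, norm_mul, norm_pow, hnt, abs_of_pos ht0, Complex.norm_two]
      gcongr
    have e3 : ‖(a : ℂ) * (t : ℂ) * g (t ^ 2) * W' (a * t)‖ ≤
        a * t * 1 * (K / (a * t * Real.sqrt u₀)) := by
      rw [norm_mul, norm_mul, norm_mul, hnt, hnt, abs_of_pos ht0, abs_of_pos ha]
      gcongr
    calc _ ≤ ‖g (t ^ 2) * W (a * t) + 2 * (t : ℂ) ^ 2 * deriv g (t ^ 2) * W (a * t)‖ +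
          ‖(a : ℂ) * (t : ℂ) * g (t ^ 2) * W' (a * t)‖ := norm_add_le _ _
      _ ≤ ‖g (t ^ 2) * W (a * t)‖ + ‖2 * (t : ℂ) ^ 2 * deriv g (t ^ 2) * W (a * t)‖ +
          ‖(a : ℂ) * (t : ℂ) * g (t ^ 2) * W' (a * t)‖ := by gcongr; exact norm_add_le _ _
      _ ≤ 1 * (K / Real.sqrt u₀) + 2 * t ^ 2 * (1 / t ^ 2) * (K / Real.sqrt u₀) +
          a * t * 1 * (K / (a * t * Real.sqrt u₀)) := by gcongr
      _ = 4 * K / Real.sqrt u₀ := by field_simp; ring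
  have ha₂ : ∀ t ∈ Icc t₁ t₂, ‖A'' t‖ ≤ 17 * K / (t₁ * Real.sqrt u₀) := by
    intro t ht
    obtain ⟨ht0, htt₂, -, -, hat0⟩ := hI t ht
    obtain ⟨b0, b1, b2, w0, w1, w2⟩ := hB t ht
    have hat : 0 < a * t := mul_pos ha ht0
    have htt₁ : t₁ ≤ t := ht.1
    simp only [hA'']
    have e1 : ‖6 * (t : ℂ) * deriv g (t ^ 2) * W (a * t)‖ ≤ 6 * t * (1 / t ^ 2) * (K / Real.sqrt u₀) := by
      rw [norm_mul, norm_mul, norm_mul, hnt, abs_of_pos ht0, Complex.norm_ofNat]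
      gcongr
    have e2 : ‖4 * (t : ℂ) ^ 3 * deriv (deriv g) (t ^ 2) * W (a * t)‖ ≤
        4 * t ^ 3 * (1 / t ^ 4) * (K / Real.sqrt u₀) := by
      rw [norm_mul, norm_mul, norm_mul, norm_pow, hnt, abs_of_pos ht0, Complex.norm_ofNat]
      gcongr
    have e3 : ‖2 * (a : ℂ) * g (t ^ 2) * W' (a * t)‖ ≤ 2 * a * 1 * (K / (a * t * Real.sqrt u₀)) := by
      rw [norm_mul, norm_mul, norm_mul, hnt, abs_of_pos ha, Complex.norm_two]
      gcongr
    have e4 : ‖4 * (a : ℂ) * (t : ℂ) ^ 2 * deriv g (t ^ 2) * W' (a * t)‖ ≤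
        4 * a * t ^ 2 * (1 / t ^ 2) * (K / (a * t * Real.sqrt u₀)) := by
      rw [norm_mul, norm_mul, norm_mul, norm_mul, norm_pow, hnt, hnt, abs_of_pos ht0, abs_of_pos ha,
        Complex.norm_ofNat]
      gcongr
    have e5 : ‖(a : ℂ) ^ 2 * t * g (t ^ 2) * W'' (a * t)‖ ≤
        a ^ 2 * t * 1 * (K / ((a * t) ^ 2 * Real.sqrt u₀)) := by
      rw [norm_mul, norm_mul, norm_mul, norm_pow, hnt, hnt, abs_of_pos ht0, abs_of_pos ha]
      gcongr
    calc _ ≤ ‖6 * (t : ℂ) * deriv g (t ^ 2) * W (a * t) + 4 * (t : ℂ) ^ 3 * deriv (deriv g) (t ^ 2) * W (a * t)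
            + 2 * (a : ℂ) * g (t ^ 2) * W' (a * t) + 4 * (a : ℂ) * (t : ℂ) ^ 2 * deriv g (t ^ 2) * W' (a * t)‖
            + ‖(a : ℂ) ^ 2 * t * g (t ^ 2) * W'' (a * t)‖ := norm_add_le _ _
      _ ≤ ‖6 * (t : ℂ) * deriv g (t ^ 2) * W (a * t)‖ + ‖4 * (t : ℂ) ^ 3 * deriv (deriv g) (t ^ 2) * W (a * t)‖
            + ‖2 * (a : ℂ) * g (t ^ 2) * W' (a * t)‖ + ‖4 * (a : ℂ) * (t : ℂ) ^ 2 * deriv g (t ^ 2) * W' (a * t)‖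
            + ‖(a : ℂ) ^ 2 * t * g (t ^ 2) * W'' (a * t)‖ := by
          gcongr
          refine (norm_add_le _ _).trans ?_
          gcongr
          refine (norm_add_le _ _).trans ?_
          gcongr
          exact norm_add_le _ _
      _ ≤ 6 * t * (1 / t ^ 2) * (K / Real.sqrt u₀) + 4 * t ^ 3 * (1 / t ^ 4) * (K / Real.sqrt u₀)
            + 2 * a * 1 * (K / (a * t * Real.sqrt u₀)) + 4 * a * t ^ 2 * (1 / t ^ 2) * (K / (a * t * Real.sqrt u₀))
            + a ^ 2 * t * 1 * (K / ((a * t) ^ 2 * Real.sqrt u₀)) := by gcongr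
      _ = 17 * K / (t * Real.sqrt u₀) := by field_simp; ring
      _ ≤ 17 * K / (t₁ * Real.sqrt u₀) := by
          apply div_le_div_of_nonneg_left (by positivity) (by positivity)
          gcongr
  -- two integrations by parts
  have key := norm_integral_mul_cexp_le_of_nonstationary ht₁₂ hAd hA'd hA''c hφd hφ'd hφ''d hφ'''c
    hAz₁ hAz₂ hA'z₁ hA'z₂ (μ := a / 4) (by positivity) hμ hM₂ hM₃ ha₀ ha₁ ha₂
  -- match the integrands
  have hint : ∫ t in t₁..t₂, (t : ℂ) * g (t ^ 2) * W (a * t) *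
      cexp (I * (ε * a * t - 2 * Real.pi * α * t ^ 2 : ℝ)) = ∫ t in t₁..t₂, A t * cexp (I * φ t) := by
    rfl
  rw [hint]
  refine key.trans ?_
  clear key hint
  clear_value A A' A'' φ φ' φ'' φ''' u₀ t₁ t₂
  -- simplify the bound: `t₂ ≤ 2t₁`, `4π|α|t₂ ≤ 3a/4`
  have ht₂le : t₂ ≤ 2 * t₁ := by
    have e : (2 : ℝ) * Real.sqrt X = Real.sqrt (2 ^ 2 * X) := by
      rw [Real.sqrt_mul (by norm_num), Real.sqrt_sq (by norm_num)]
    rw [ht₂, ht₁, e]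
    exact Real.sqrt_le_sqrt (by linarith)
  have ht₂0 : 0 ≤ t₂ := le_trans ht₁0.le ht₁₂
  have hz0 : 0 ≤ 4 * Real.pi * |α| * t₂ := by positivity
  have hQ : 0 ≤ K / (a ^ 2 * Real.sqrt u₀) := by positivity
  have hsu₀ne : Real.sqrt u₀ ≠ 0 := hsu₀.ne'
  have ht₁ne : t₁ ≠ 0 := ht₁0.ne'
  have hane : a ≠ 0 := ha.ne'
  have e1 : t₂ * (17 * K / (t₁ * Real.sqrt u₀) / (a / 4) ^ 2) ≤ 544 * (K / (a ^ 2 * Real.sqrt u₀)) := by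
    have : t₂ * (17 * K / (t₁ * Real.sqrt u₀) / (a / 4) ^ 2) =
        (t₂ / t₁) * (272 * (K / (a ^ 2 * Real.sqrt u₀))) := by
      field_simp
      ring
    rw [this]
    have h2 : t₂ / t₁ ≤ 2 := by rw [div_le_iff₀ ht₁0]; linarith
    calc t₂ / t₁ * (272 * (K / (a ^ 2 * Real.sqrt u₀))) ≤ 2 * (272 * (K / (a ^ 2 * Real.sqrt u₀))) :=
          mul_le_mul_of_nonneg_right h2 (by positivity)
      _ = 544 * (K / (a ^ 2 * Real.sqrt u₀)) := by ring
  have e2 : t₂ * (3 * (4 * K / Real.sqrt u₀) * (4 * Real.pi * |α|) / (a / 4) ^ 3) ≤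
      576 * (K / (a ^ 2 * Real.sqrt u₀)) := by
    have : t₂ * (3 * (4 * K / Real.sqrt u₀) * (4 * Real.pi * |α|) / (a / 4) ^ 3) =
        (4 * Real.pi * |α| * t₂) / a * (768 * (K / (a ^ 2 * Real.sqrt u₀))) := by
      field_simp
      ring
    rw [this]
    have h2 : 4 * Real.pi * |α| * t₂ / a ≤ 3 / 4 := by rw [div_le_iff₀ ha]; linarith
    calc 4 * Real.pi * |α| * t₂ / a * (768 * (K / (a ^ 2 * Real.sqrt u₀)))
        ≤ 3 / 4 * (768 * (K / (a ^ 2 * Real.sqrt u₀))) :=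
          mul_le_mul_of_nonneg_right h2 (by positivity)
      _ = 576 * (K / (a ^ 2 * Real.sqrt u₀)) := by ring
  have e3 : t₂ * (3 * (t₂ * K / Real.sqrt u₀) * (4 * Real.pi * |α|) ^ 2 / (a / 4) ^ 4) ≤
      432 * (K / (a ^ 2 * Real.sqrt u₀)) := by
    have : t₂ * (3 * (t₂ * K / Real.sqrt u₀) * (4 * Real.pi * |α|) ^ 2 / (a / 4) ^ 4) =
        ((4 * Real.pi * |α| * t₂) / a) ^ 2 * (768 * (K / (a ^ 2 * Real.sqrt u₀))) := by
      field_simp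
      ring
    rw [this]
    have h2 : 4 * Real.pi * |α| * t₂ / a ≤ 3 / 4 := by rw [div_le_iff₀ ha]; linarith
    have h3 : 0 ≤ 4 * Real.pi * |α| * t₂ / a := by positivity
    have h4 : (4 * Real.pi * |α| * t₂ / a) ^ 2 ≤ (3 / 4) ^ 2 := pow_le_pow_left₀ h3 h2 2
    calc (4 * Real.pi * |α| * t₂ / a) ^ 2 * (768 * (K / (a ^ 2 * Real.sqrt u₀)))
        ≤ (3 / 4) ^ 2 * (768 * (K / (a ^ 2 * Real.sqrt u₀))) :=
          mul_le_mul_of_nonneg_right h4 (by positivity)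
      _ = 432 * (K / (a ^ 2 * Real.sqrt u₀)) := by ring
  have ha4 : 0 ≤ a / 4 := div_nonneg ha.le zero_le_four
  have h17K : (0 : ℝ) ≤ 17 * K := mul_nonneg (by norm_num) hK
  have h4K : (0 : ℝ) ≤ 4 * K := mul_nonneg zero_le_four hK
  have hπα : 0 ≤ 4 * Real.pi * |α| :=
    mul_nonneg (mul_nonneg zero_le_four Real.pi_pos.le) (abs_nonneg α)
  have n1 : 0 ≤ 17 * K / (t₁ * Real.sqrt u₀) / (a / 4) ^ 2 :=
    div_nonneg (div_nonneg h17K (mul_nonneg ht₁0.le hsu₀.le)) (pow_nonneg ha4 2)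
  have n2 : 0 ≤ 3 * (4 * K / Real.sqrt u₀) * (4 * Real.pi * |α|) / (a / 4) ^ 3 :=
    div_nonneg (mul_nonneg (mul_nonneg zero_le_three (div_nonneg h4K hsu₀.le)) hπα)
      (pow_nonneg ha4 3)
  have n3 : t₂ * K / Real.sqrt u₀ * 0 / (a / 4) ^ 3 = 0 := by simp
  have n4 : 0 ≤ 3 * (t₂ * K / Real.sqrt u₀) * (4 * Real.pi * |α|) ^ 2 / (a / 4) ^ 4 :=
    div_nonneg (mul_nonneg (mul_nonneg zero_le_three (div_nonneg (mul_nonneg ht₂0 hK) hsu₀.le))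
      (sq_nonneg _)) (pow_nonneg ha4 4)
  rw [n3, add_zero]
  have hsum : 0 ≤ 17 * K / (t₁ * Real.sqrt u₀) / (a / 4) ^ 2 +
      3 * (4 * K / Real.sqrt u₀) * (4 * Real.pi * |α|) / (a / 4) ^ 3 +
      3 * (t₂ * K / Real.sqrt u₀) * (4 * Real.pi * |α|) ^ 2 / (a / 4) ^ 4 :=
    add_nonneg (add_nonneg n1 n2) n4
  calc (t₂ - t₁) * (17 * K / (t₁ * Real.sqrt u₀) / (a / 4) ^ 2 +
        3 * (4 * K / Real.sqrt u₀) * (4 * Real.pi * |α|) / (a / 4) ^ 3 +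
        3 * (t₂ * K / Real.sqrt u₀) * (4 * Real.pi * |α|) ^ 2 / (a / 4) ^ 4)
      ≤ t₂ * (17 * K / (t₁ * Real.sqrt u₀) / (a / 4) ^ 2 +
        3 * (4 * K / Real.sqrt u₀) * (4 * Real.pi * |α|) / (a / 4) ^ 3 +
        3 * (t₂ * K / Real.sqrt u₀) * (4 * Real.pi * |α|) ^ 2 / (a / 4) ^ 4) :=
        mul_le_mul_of_nonneg_right (by linarith [ht₁0.le]) hsum
    _ = t₂ * (17 * K / (t₁ * Real.sqrt u₀) / (a / 4) ^ 2) +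
        t₂ * (3 * (4 * K / Real.sqrt u₀) * (4 * Real.pi * |α|) / (a / 4) ^ 3) +
        t₂ * (3 * (t₂ * K / Real.sqrt u₀) * (4 * Real.pi * |α|) ^ 2 / (a / 4) ^ 4) := by ring
    _ ≤ 544 * (K / (a ^ 2 * Real.sqrt u₀)) + 576 * (K / (a ^ 2 * Real.sqrt u₀)) +
        432 * (K / (a ^ 2 * Real.sqrt u₀)) := add_le_add (add_le_add e1 e2) e3
    _ = 1552 * K / (a ^ 2 * Real.sqrt u₀) := by ring

end Piece

end ConreyIwaniec2002

end Literature.NumberTheory.LFunctions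

end
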